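import Literature.MathematicalPhysics.QuantumFieldTheory.Dimock2015.AnalyticLipschitz
import Literature.MathematicalPhysics.QuantumFieldTheory.Balaban1983to89.FlowStep

/-!
# EriceRemainderEnclosureHistoryAnalyticWalsh — (E31b) THE WALSH–HADAMARD BLOCK FUNCTIONAL: an ENTIRE cubic polynomial of
# `k + 1` complex couplings, bounded by `R³` on every polydisc and of (AF-1) type `|f p| ≤ γ₀²·p_k` on the real box, EVERY
# history-Lipschitz weight vector of which gives weight `≥ c·γ²·n∕4` to EACH of the `n` block couplings

Cell `pub-balaban`, β-function sub-cell, BINDER row D4 «RemainderConst leaves for Bałaban's split» (`HOME/BINDER-OWNERS.md`; owner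
lineage `b2b-balaban-beta-an4`; this file by co-owner #2 lineage `b2b-balaban-beta-d4-p2`, generation 33), β-FLOW TEAM duty (1)
under the rulings «YM REDIRECT» (FREEZE (0) honoured: def-free module in the lineage's `EriceRemainderEnclosure*` series, no new leaf)
and «YM ACCELERATION» item (2).  ROLE.  The algebraic engine of station (E31) «ANALYTICITY IN ALL THE COUPLINGS IS NOT MEMORY»
(companions `…HistoryAnalytic` = the positive dictionary, `…HistoryAnalyticSharp` = the END).  The question: does [Balaban1987RG1]
p. 266 tl. 33–37 *«the functions E^{(j)}, β_j are analytic functions of the effective coupling constants»*, read in ALL the couplings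
with constants uniform in the scale and in the number of variables, imply a history modulus `T4CouplingMatching.HistLipschitz Λ γ β`
of `k`-uniformly bounded total weight `Σ_{i≤k} Λ k i` (the located input of (D4-J2)'s history half, of (E30)'s two-loop law and of
node U2's two-run matching)?  NO — and this file builds the witness at ONE level `k`: for a finite index set `X` carrying a real
HADAMARD datum `H` (entries `±1`, symmetric, orthogonal rows `Σ_y H x y·H x' y = n·[x = x']`, one all-ones row) injected by
`e : X ↪ Fin (k+1)` below the last coordinate, the functional `f p = p_k · c · Σ_{x,y} H x y · p (e x) · p (e y)`.  Orthogonality makes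
the COMPLEX quadratic form small (`≤ √n·Σ‖z‖²`, so `‖F‖ ≤ R³` on polydiscs when `c = n^{−3∕2}`), while flatness of the entries makes
every coordinate derivative large somewhere on the real box (test history: `γ` on the `+1` entries of a row, `γ∕2` on the `−1` entries),
so each block weight is `≥ c·γ²·n∕4` and their sum `≥ c·γ²·n²∕4 = γ²·√n∕4`.  The WALSH signs `∏_i (−1)^{[x_i ∧ y_i]}` on `X = Fin m → Bool`
are such a datum with `n = 2^m` (row orthogonality = a character sum over `(ℤ∕2)^m`, computed as `∏_i Σ_{b ∈ Bool}`).

HONEST FRAMING (page 1 of everything the β sub-cell writes).  *"Discharging BetaPertH makes Bałaban's UV stability UNCONDITIONAL —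
a real constructive-QFT result; it is NOT the continuum limit and NOT the Clay problem."*  THIS FILE DISCHARGES NOTHING OF THE
KIND: it is [folklore] finite-dimensional algebra and calculus (Cauchy–Schwarz, `Finset.sum_prod_piFinset`, `fun_prop`) about an
explicit polynomial; NOTHING of [I] (1.22) or of Bałaban's β-functions is asserted, constructed or instantiated — the functional is a
TEST OBJECT for the typed hypothesis shapes (`FlowStep.Box`, the history-Lipschitz inequality), not a model of [I].  Row D4 class
UNCHANGED (critical-path width 0; instance 0∕1; D4 DISCHARGE NO DATE); NOT B12 Thm 2, NOT BetaPertH, NOT continuum, NOT Clay.  HONEST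
DEPENDENCY: continuum YM on T⁴ ⇐ BetaPertH ∧ nine spine estimates (0/9 proved); BetaPertH ⇐ (D1) ∧ (D4) ∧ CAP+tail; G-an2-4 gates asym,
D1 and NE2/3/4.  ABSOLUTE RULE: nothing is cited as a fact; every statement is proved about the typed shapes.

WHAT IS PROVED ([folklore]; 0 sorry; 0 `def`; all data abstract: `X`, `H`, `e`, `c`, `f` with displayed hypotheses).  §1 HADAMARD
ALGEBRA: `hadamard_rowSum` (`Σ_y H x y = n·[x = x₀]`), `hadamard_colOrth`, `hadamard_sum_sq` (`‖Hv‖² = n‖v‖²`), `hadamard_abs_quad_le`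
(real form `≤ √n·‖v‖²`), `hadamard_norm_cquad_le` (COMPLEX form `≤ √n·Σ‖z‖²`, real and imaginary parts separately),
`hadamard_testRow_ge` (the test row sum `≥ γn∕4`).  §2 WALSH INSTANCE on `Fin m → Bool`: `walsh_sym`, `walsh_one`, `walsh_row0`,
**`walsh_orth`**.  §3 THE LEVEL-`k` FUNCTIONAL: `witness_differentiable` (entire), `witness_ofReal`, **`witness_norm_le`**
(`‖F z‖ ≤ R·c·√n·n·R²` on `‖z_i‖ ≤ R`), **`witness_abs_le`** (`|f p| ≤ c·√n·n·γ₀²·p_k` on the box), `quad_update`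
(`Q(u − tδ_a) = Q(u) − 2t(Hu)_a + t²H a a`), `lift_apply_block` ∕ `lift_apply_off`, and **`blockWeight_ge`**: if
`|f p − f q| ≤ Σ_i Λ_i |p_i − q_i|` on ]0,γ]^{k+1} then `Λ (e a) ≥ c·γ²·n∕4` for every block index `a`.
-/

noncomputable section

open Finset Metric Set

namespace Summit.QuantumFields.BalabanUV.Beta.EriceRemainderEnclosureHistoryAnalyticWalsh

open Literature.MathematicalPhysics.QuantumFieldTheory.Balaban1983to89.FlowStep (Box mem_box)

/-! ## §1 Hadamard algebra over an abstract datum -/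

section Hadamard

variable {X : Type*} [Fintype X] [DecidableEq X] {H : X → X → ℝ}

/-- Row sums of a Hadamard datum with an all-ones row `x₀`: `Σ_y H x y = n·[x = x₀]`. [folklore] -/
theorem hadamard_rowSum
    (horth : ∀ x x', ∑ y, H x y * H x' y = if x = x' then (Fintype.card X : ℝ) else 0)
    {x₀ : X} (hrow : ∀ y, H x₀ y = 1) (x : X) :
    ∑ y, H x y = if x = x₀ then (Fintype.card X : ℝ) else 0 := by
  have h := horth x x₀
  simpa [hrow] using h

/-- Column orthogonality from row orthogonality and symmetry. [folklore] -/
theorem hadamard_colOrth (hsym : ∀ x y, H x y = H y x)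
    (horth : ∀ x x', ∑ y, H x y * H x' y = if x = x' then (Fintype.card X : ℝ) else 0) (y y' : X) :
    ∑ x, H x y * H x y' = if y = y' then (Fintype.card X : ℝ) else 0 := by
  rw [← horth y y']
  exact sum_congr rfl fun x _ => by rw [hsym x y, hsym x y']

/-- `‖H v‖² = n‖v‖²`: `Σ_x (Σ_y H x y v y)² = n·Σ_y v y²`. [folklore] -/
theorem hadamard_sum_sq (hsym : ∀ x y, H x y = H y x)
    (horth : ∀ x x', ∑ y, H x y * H x' y = if x = x' then (Fintype.card X : ℝ) else 0) (v : X → ℝ) :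
    ∑ x, (∑ y, H x y * v y) ^ 2 = (Fintype.card X : ℝ) * ∑ y, v y ^ 2 := by
  calc ∑ x, (∑ y, H x y * v y) ^ 2
      = ∑ x, ∑ y, ∑ y', (H x y * H x y') * (v y * v y') := by
        refine sum_congr rfl fun x _ => ?_
        rw [sq, sum_mul_sum]
        exact sum_congr rfl fun y _ => sum_congr rfl fun y' _ => by ring
    _ = ∑ y, ∑ y', (∑ x, H x y * H x y') * (v y * v y') := by
        rw [sum_comm]
        refine sum_congr rfl fun y _ => ?_
        rw [sum_comm]
        exact sum_congr rfl fun y' _ => by rw [sum_mul]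
    _ = ∑ y, ∑ y', (if y = y' then (Fintype.card X : ℝ) else 0) * (v y * v y') := by
        refine sum_congr rfl fun y _ => sum_congr rfl fun y' _ => ?_
        rw [hadamard_colOrth hsym horth]
    _ = (Fintype.card X : ℝ) * ∑ y, v y ^ 2 := by
        simp only [ite_mul, zero_mul, sum_ite_eq, mul_sum]
        exact sum_congr rfl fun y _ => by rw [if_pos (Finset.mem_univ y)]; ring

/-- The real quadratic form is bounded by `√n·‖v‖²`: `|Σ_x v x (Σ_y H x y v y)| ≤ √n·Σ_x v x²`. [folklore] -/
theorem hadamard_abs_quad_le (hsym : ∀ x y, H x y = H y x)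
    (horth : ∀ x x', ∑ y, H x y * H x' y = if x = x' then (Fintype.card X : ℝ) else 0) (v : X → ℝ) :
    |∑ x, v x * ∑ y, H x y * v y| ≤ Real.sqrt (Fintype.card X) * ∑ x, v x ^ 2 := by
  set S := ∑ x, v x ^ 2 with hSdef
  have hS : 0 ≤ S := sum_nonneg fun _ _ => sq_nonneg _
  have hcs := sum_mul_sq_le_sq_mul_sq univ v (fun x => ∑ y, H x y * v y)
  rw [hadamard_sum_sq hsym horth] at hcs
  calc |∑ x, v x * ∑ y, H x y * v y| ≤ Real.sqrt (S * ((Fintype.card X : ℝ) * S)) := Real.abs_le_sqrt hcs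
    _ = Real.sqrt (Fintype.card X) * S := by
        rw [show S * ((Fintype.card X : ℝ) * S) = (Fintype.card X : ℝ) * (S * S) by ring,
          Real.sqrt_mul (Nat.cast_nonneg _), Real.sqrt_mul_self hS]

/-- The COMPLEX quadratic form is bounded by `√n·Σ‖z‖²` (`H` has real entries: real and imaginary parts separate). [folklore] -/
theorem hadamard_norm_cquad_le (hsym : ∀ x y, H x y = H y x)
    (horth : ∀ x x', ∑ y, H x y * H x' y = if x = x' then (Fintype.card X : ℝ) else 0) (z : X → ℂ) :
    ‖∑ x, z x * ∑ y, (H x y : ℂ) * z y‖ ≤ Real.sqrt (Fintype.card X) * ∑ x, ‖z x‖ ^ 2 := by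
  have hre : ∀ x, (∑ y, (H x y : ℂ) * z y).re = ∑ y, H x y * (z y).re := fun x => by
    rw [Complex.re_sum]
    exact sum_congr rfl fun y _ => Complex.re_ofReal_mul _ _
  have him : ∀ x, (∑ y, (H x y : ℂ) * z y).im = ∑ y, H x y * (z y).im := fun x => by
    rw [Complex.im_sum]
    exact sum_congr rfl fun y _ => Complex.im_ofReal_mul _ _
  have e1 : ∀ w : ℂ, ‖w‖ ^ 2 = w.re ^ 2 + w.im ^ 2 := fun w => by
    rw [Complex.sq_norm, Complex.normSq_apply]; ring
  have hsq : ∑ x, ‖∑ y, (H x y : ℂ) * z y‖ ^ 2 = (Fintype.card X : ℝ) * ∑ x, ‖z x‖ ^ 2 := by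
    simp_rw [e1, hre, him, sum_add_distrib, hadamard_sum_sq hsym horth, mul_add]
  set S := ∑ x, ‖z x‖ ^ 2 with hSdef
  have hS : 0 ≤ S := sum_nonneg fun _ _ => sq_nonneg _
  have hcs := sum_mul_sq_le_sq_mul_sq univ (fun x => ‖z x‖) (fun x => ‖∑ y, (H x y : ℂ) * z y‖)
  rw [hsq] at hcs
  calc ‖∑ x, z x * ∑ y, (H x y : ℂ) * z y‖ ≤ ∑ x, ‖z x * ∑ y, (H x y : ℂ) * z y‖ := norm_sum_le _ _
    _ = ∑ x, ‖z x‖ * ‖∑ y, (H x y : ℂ) * z y‖ := sum_congr rfl fun x _ => norm_mul _ _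
    _ ≤ Real.sqrt (S * ((Fintype.card X : ℝ) * S)) := Real.le_sqrt_of_sq_le hcs
    _ = Real.sqrt (Fintype.card X) * S := by
        rw [show S * ((Fintype.card X : ℝ) * S) = (Fintype.card X : ℝ) * (S * S) by ring,
          Real.sqrt_mul (Nat.cast_nonneg _), Real.sqrt_mul_self hS]

/-- The weighted row sum against the test vector `γ` on `+1` entries, `γ∕2` on `−1` entries is at least `γn∕4`. [folklore] -/
theorem hadamard_testRow_ge
    (horth : ∀ x x', ∑ y, H x y * H x' y = if x = x' then (Fintype.card X : ℝ) else 0)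
    (hone : ∀ x y, H x y = 1 ∨ H x y = -1) {x₀ : X} (hrow : ∀ y, H x₀ y = 1) {γ : ℝ} (hγ : 0 ≤ γ) (x : X) :
    γ * (Fintype.card X : ℝ) / 4 ≤ ∑ y, H x y * (if H x y = 1 then γ else γ / 2) := by
  have hterm : ∀ y, H x y * (if H x y = 1 then γ else γ / 2) = γ / 4 * (3 * H x y + 1) := by
    intro y
    rcases hone x y with h | h
    · rw [h, if_pos rfl]; ring
    · rw [h, if_neg (by norm_num)]; ring
  simp_rw [hterm]
  rw [← mul_sum, sum_add_distrib, sum_const, card_univ, nsmul_eq_mul, mul_one, ← mul_sum,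
    hadamard_rowSum horth hrow x]
  split_ifs
  · nlinarith [(Nat.cast_nonneg (Fintype.card X) : (0:ℝ) ≤ _)]
  · nlinarith [(Nat.cast_nonneg (Fintype.card X) : (0:ℝ) ≤ _)]

end Hadamard

/-! ## §2 The Walsh instance on `Fin m → Bool` -/

section Walsh

/-- The Walsh sign `∏ i [x i ∧ y i ↦ −1]` is symmetric. [folklore] -/
theorem walsh_sym (m : ℕ) (x y : Fin m → Bool) :
    (∏ i, if (x i && y i) = true then (-1 : ℝ) else 1) = ∏ i, if (y i && x i) = true then (-1 : ℝ) else 1 := by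
  simp_rw [Bool.and_comm]

/-- The Walsh sign is `±1`. [folklore] -/
theorem walsh_one (m : ℕ) (x y : Fin m → Bool) :
    (∏ i, if (x i && y i) = true then (-1 : ℝ) else 1) = 1 ∨
      (∏ i, if (x i && y i) = true then (-1 : ℝ) else 1) = -1 := by
  refine Finset.prod_induction _ (fun t : ℝ => t = 1 ∨ t = -1) ?_ (Or.inl rfl) ?_
  · rintro a b (rfl | rfl) (rfl | rfl) <;> norm_num
  · intro i _
    split_ifs
    · exact Or.inr rfl
    · exact Or.inl rfl

/-- The row of `x₀ = (false, …, false)` is all ones. [folklore] -/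
theorem walsh_row0 (m : ℕ) (y : Fin m → Bool) :
    (∏ i, if ((fun _ : Fin m => false) i && y i) = true then (-1 : ℝ) else 1) = 1 := by
  simp

/-- Row orthogonality: `Σ_y W x y · W x' y = 2^m·[x = x']` (a character sum over `(ℤ∕2)^m`, computed as
`∏_i Σ_{b ∈ Bool}` by `Finset.sum_prod_piFinset`). [folklore] -/
theorem walsh_orth (m : ℕ) (x x' : Fin m → Bool) :
    ∑ y : Fin m → Bool, (∏ i, if (x i && y i) = true then (-1 : ℝ) else 1) *
        (∏ i, if (x' i && y i) = true then (-1 : ℝ) else 1) =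
      if x = x' then (Fintype.card (Fin m → Bool) : ℝ) else 0 := by
  simp_rw [← prod_mul_distrib]
  have h := Finset.sum_prod_piFinset (univ : Finset Bool)
    (fun (i : Fin m) (b : Bool) => (if (x i && b) = true then (-1 : ℝ) else 1) * (if (x' i && b) = true then (-1 : ℝ) else 1))
  rw [Fintype.piFinset_univ] at h
  rw [h]
  have hfac : ∀ i : Fin m, ∑ b : Bool, (if (x i && b) = true then (-1 : ℝ) else 1) *
      (if (x' i && b) = true then (-1 : ℝ) else 1) = if x i = x' i then 2 else 0 := by
    intro i
    rw [Fintype.sum_bool]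
    cases x i <;> cases x' i <;> norm_num
  simp_rw [hfac]
  split_ifs with hx
  · subst hx
    simp only [if_true, prod_const, card_univ, Fintype.card_fin]
    rw [Fintype.card_fun, Fintype.card_bool, Fintype.card_fin]
    push_cast; ring
  · obtain ⟨i, hi⟩ : ∃ i, x i ≠ x' i := by
      simpa [funext_iff] using hx
    exact prod_eq_zero (mem_univ i) (if_neg hi)

end Walsh

/-! ## §3 The level-`k` functional: `f p = p_k · c · Σ_{x,y} H x y · p (e x) · p (e y)` on an injected block of coordinates -/

section Witness

variable {X : Type*} [Fintype X] [DecidableEq X] {H : X → X → ℝ} {k : ℕ} {e : X → Fin (k + 1)} {c : ℝ}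
  {f : (Fin (k + 1) → ℝ) → ℝ}

omit [DecidableEq X] in
/-- The witness is the restriction to real histories of an ENTIRE function of the `k + 1` complex couplings (a cubic polynomial).
[folklore] -/
theorem witness_differentiable (H : X → X → ℝ) (e : X → Fin (k + 1)) (c : ℝ) :
    Differentiable ℂ fun z : Fin (k + 1) → ℂ =>
      z (Fin.last k) * ((c : ℂ) * ∑ x, z (e x) * ∑ y, (H x y : ℂ) * z (e y)) := by
  fun_prop

omit [DecidableEq X] in
/-- The entire function agrees with `f` on real histories. [folklore] -/
theorem witness_ofReal (hf : ∀ p, f p = p (Fin.last k) * (c * ∑ x, p (e x) * ∑ y, H x y * p (e y)))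
    (p : Fin (k + 1) → ℝ) :
    (fun z : Fin (k + 1) → ℂ => z (Fin.last k) * ((c : ℂ) * ∑ x, z (e x) * ∑ y, (H x y : ℂ) * z (e y)))
        (fun i => (p i : ℂ)) = ((f p : ℝ) : ℂ) := by
  rw [hf p]; push_cast; rfl

/-- UNIFORM BOUND ON COMPLEX POLYDISCS: `‖F z‖ ≤ R·c·√n·n·R²` whenever `‖z i‖ ≤ R` for all `i` — with `c = 1∕(n√n)` this is `R³`,
INDEPENDENT of the number `k + 1` of couplings and of the block size `n`. [folklore] -/
theorem witness_norm_le (hsym : ∀ x y, H x y = H y x)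
    (horth : ∀ x x', ∑ y, H x y * H x' y = if x = x' then (Fintype.card X : ℝ) else 0)
    (e : X → Fin (k + 1)) (hc : 0 ≤ c) {R : ℝ} (z : Fin (k + 1) → ℂ) (hz : ∀ i, ‖z i‖ ≤ R) :
    ‖z (Fin.last k) * ((c : ℂ) * ∑ x, z (e x) * ∑ y, (H x y : ℂ) * z (e y))‖ ≤
      R * (c * (Real.sqrt (Fintype.card X) * ((Fintype.card X : ℝ) * R ^ 2))) := by
  have hR : 0 ≤ R := (norm_nonneg _).trans (hz (Fin.last k))
  rw [norm_mul, norm_mul, Complex.norm_real, Real.norm_of_nonneg hc]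
  have h1 := hadamard_norm_cquad_le hsym horth (fun x => z (e x))
  have h2 : ∑ x, ‖z (e x)‖ ^ 2 ≤ (Fintype.card X : ℝ) * R ^ 2 := by
    calc ∑ x, ‖z (e x)‖ ^ 2 ≤ ∑ _x : X, R ^ 2 := sum_le_sum fun x _ => pow_le_pow_left₀ (norm_nonneg _) (hz _) 2
      _ = (Fintype.card X : ℝ) * R ^ 2 := by rw [sum_const, card_univ, nsmul_eq_mul]
  have h3 : ‖∑ x, z (e x) * ∑ y, (H x y : ℂ) * z (e y)‖ ≤ Real.sqrt (Fintype.card X) * ((Fintype.card X : ℝ) * R ^ 2) :=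
    h1.trans (mul_le_mul_of_nonneg_left h2 (Real.sqrt_nonneg _))
  exact mul_le_mul (hz _) (mul_le_mul_of_nonneg_left h3 hc) (by positivity) hR

/-- ON THE REAL BOX the witness is a REMAINDER OF (AF-1) TYPE: `|f p| ≤ (c·√n·n·γ₀²)·p_k` on ]0,γ₀]^{k+1} — with `c = 1∕(n√n)`,
`|f p| ≤ γ₀²·p_k` uniformly in `k` and `n`. [folklore] -/
theorem witness_abs_le (hsym : ∀ x y, H x y = H y x)
    (horth : ∀ x x', ∑ y, H x y * H x' y = if x = x' then (Fintype.card X : ℝ) else 0)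
    (hf : ∀ p, f p = p (Fin.last k) * (c * ∑ x, p (e x) * ∑ y, H x y * p (e y))) (hc : 0 ≤ c)
    {γ₀ : ℝ} {p : Fin (k + 1) → ℝ} (hp : p ∈ Box γ₀ k) :
    |f p| ≤ c * (Real.sqrt (Fintype.card X) * ((Fintype.card X : ℝ) * γ₀ ^ 2)) * p (Fin.last k) := by
  have hpos := fun i => mem_box.1 hp i
  rw [hf p, abs_mul, abs_of_pos (hpos _).1, abs_mul, abs_of_nonneg hc, mul_comm]
  refine mul_le_mul_of_nonneg_right (mul_le_mul_of_nonneg_left ?_ hc) (hpos _).1.le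
  refine (hadamard_abs_quad_le hsym horth _).trans (mul_le_mul_of_nonneg_left ?_ (Real.sqrt_nonneg _))
  calc ∑ x, p (e x) ^ 2 ≤ ∑ _x : X, γ₀ ^ 2 := sum_le_sum fun x _ => pow_le_pow_left₀ (hpos _).1.le (hpos _).2 2
    _ = (Fintype.card X : ℝ) * γ₀ ^ 2 := by rw [sum_const, card_univ, nsmul_eq_mul]

/-- The quadratic form after lowering ONE block coordinate by `t`:
`Q(u − t·δ_a) = Q(u) − 2t·(Hu)_a + t²·H a a` (symmetry of `H`). [folklore] -/
theorem quad_update (hsym : ∀ x y, H x y = H y x) (u : X → ℝ) (a : X) (t : ℝ) :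
    ∑ x, (u x - if x = a then t else 0) * ∑ y, H x y * (u y - if y = a then t else 0) =
      ∑ x, u x * ∑ y, H x y * u y - 2 * t * ∑ y, H a y * u y + t ^ 2 * H a a := by
  have inner : ∀ x, ∑ y, H x y * (u y - if y = a then t else 0) = ∑ y, H x y * u y - t * H x a := by
    intro x
    simp only [mul_sub, sum_sub_distrib, mul_ite, mul_zero, sum_ite_eq', Finset.mem_univ, if_true]
    ring
  simp_rw [inner]
  have h1 : ∑ x, (u x - if x = a then t else 0) * (∑ y, H x y * u y - t * H x a) =
      ∑ x, u x * (∑ y, H x y * u y - t * H x a) - t * (∑ y, H a y * u y - t * H a a) := by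
    simp only [sub_mul, sum_sub_distrib, ite_mul, zero_mul, sum_ite_eq', Finset.mem_univ, if_true]
  have h2 : ∑ x, u x * (∑ y, H x y * u y - t * H x a) = ∑ x, u x * ∑ y, H x y * u y - t * ∑ y, H a y * u y := by
    rw [mul_sum, ← sum_sub_distrib]
    exact sum_congr rfl fun x _ => by rw [hsym x a]; ring
  rw [h1, h2]
  ring

omit [DecidableEq X] in
/-- The lift of a block vector `w : X → ℝ` to a history (value `d` off the block) restricts back to `w`. [folklore] -/
theorem lift_apply_block (he : Function.Injective e) (w : X → ℝ) (d : ℝ) (y : X) :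
    (fun i : Fin (k + 1) => if h : ∃ x, e x = i then w (Classical.choose h) else d) (e y) = w y := by
  have h : ∃ x, e x = e y := ⟨y, rfl⟩
  show (if h : ∃ x, e x = e y then w (Classical.choose h) else d) = w y
  rw [dif_pos h, he (Classical.choose_spec h)]

omit [DecidableEq X] in
/-- Off the block the lift takes the value `d`. [folklore] -/
theorem lift_apply_off (w : X → ℝ) (d : ℝ) {i : Fin (k + 1)} (hi : ∀ x, e x ≠ i) :
    (fun i : Fin (k + 1) => if h : ∃ x, e x = i then w (Classical.choose h) else d) i = d := by
  have h : ¬ ∃ x, e x = i := fun ⟨x, hx⟩ => hi x hx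
  show (if h : ∃ x, e x = i then w (Classical.choose h) else d) = d
  rw [dif_neg h]

/-- **THE BLOCK WEIGHTS ARE LARGE.**  If `|f p − f q| ≤ Σ_i Λ i·|p_i − q_i|` on the box ]0,γ]^{k+1}, then for every block index
`a`, `Λ (e a) ≥ c·γ²·n∕4`: test history `q` = `γ` on the `+1` entries of row `a`, `γ∕2` on the `−1` entries (and `γ` off the
block), lowered by `t = γ∕4` at `e a`; the difference of `f` is `γ·c·(2t·(Hq)_a − t²·H a a) ≥ c·γ³·n∕16` by `quad_update` and
`hadamard_testRow_ge`. [folklore] -/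
theorem blockWeight_ge (hsym : ∀ x y, H x y = H y x)
    (horth : ∀ x x', ∑ y, H x y * H x' y = if x = x' then (Fintype.card X : ℝ) else 0)
    (hone : ∀ x y, H x y = 1 ∨ H x y = -1) {x₀ : X} (hrow : ∀ y, H x₀ y = 1)
    (he : Function.Injective e) (hlast : ∀ x, e x ≠ Fin.last k)
    (hf : ∀ p, f p = p (Fin.last k) * (c * ∑ x, p (e x) * ∑ y, H x y * p (e y))) (hc : 0 ≤ c)
    {γ : ℝ} (hγ : 0 < γ) {Λ : Fin (k + 1) → ℝ}
    (hΛ : ∀ p q, p ∈ Box γ k → q ∈ Box γ k → |f p - f q| ≤ ∑ i, Λ i * |p i - q i|) (a : X) :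
    c * γ ^ 2 * (Fintype.card X : ℝ) / 4 ≤ Λ (e a) := by
  -- the test block vector and its lift
  set w : X → ℝ := fun y => if H a y = 1 then γ else γ / 2 with hw
  set q : Fin (k + 1) → ℝ := fun i => if h : ∃ x, e x = i then w (Classical.choose h) else γ with hq
  set t : ℝ := γ / 4 with ht
  set p : Fin (k + 1) → ℝ := Function.update q (e a) (q (e a) - t) with hp
  have hwval : ∀ y, w y = γ ∨ w y = γ / 2 := fun y => by
    by_cases h : H a y = 1
    · exact Or.inl (if_pos h)
    · exact Or.inr (if_neg h)
  have hwB : ∀ y, 0 < w y ∧ w y ≤ γ := fun y => by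
    rcases hwval y with h | h <;> rw [h]
    · exact ⟨hγ, le_rfl⟩
    · exact ⟨by linarith, by linarith⟩
  have hqe : ∀ y, q (e y) = w y := fun y => lift_apply_block he w γ y
  have hqlast : q (Fin.last k) = γ := lift_apply_off w γ fun x => hlast x
  have hqval : ∀ i, 0 < q i ∧ q i ≤ γ := by
    intro i
    by_cases h : ∃ x, e x = i
    · obtain ⟨x, rfl⟩ := h
      rw [hqe]; exact hwB x
    · have : q i = γ := lift_apply_off w γ fun x hx => h ⟨x, hx⟩
      rw [this]; exact ⟨hγ, le_rfl⟩
  have hqB : q ∈ Box γ k := mem_box.2 hqval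
  have hpe : ∀ y, p (e y) = w y - if y = a then t else 0 := by
    intro y
    rw [hp, Function.update_apply]
    by_cases h : y = a
    · subst h; rw [if_pos rfl, if_pos rfl, hqe]
    · rw [if_neg (fun h' => h (he h')), if_neg h, hqe, sub_zero]
  have hplast : p (Fin.last k) = γ := by
    rw [hp, Function.update_of_ne (hlast a).symm, hqlast]
  have hpB : p ∈ Box γ k := mem_box.2 fun i => by
    rw [hp, Function.update_apply]
    split_ifs with h
    · rw [hqe]
      have := hwB a
      rcases hwval a with h' | h' <;> rw [h'] <;> rw [ht] <;> constructor <;> linarith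
    · exact hqval i
  -- the Lipschitz side: Σ_i Λ i |q i − p i| = Λ (e a) · t
  have hsum : ∑ i, Λ i * |q i - p i| = Λ (e a) * t := by
    have : ∀ i, Λ i * |q i - p i| = if i = e a then Λ (e a) * t else 0 := by
      intro i
      rw [hp, Function.update_apply]
      split_ifs with h
      · subst h
        rw [show q (e a) - (q (e a) - t) = t by ring, abs_of_pos (by rw [ht]; linarith)]
      · rw [sub_self, abs_zero, mul_zero]
    simp_rw [this]
    rw [sum_ite_eq', if_pos (Finset.mem_univ _)]
  have hLip := hΛ q p hqB hpB
  rw [hsum] at hLip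
  -- the witness side: f q − f p = γ c (2t (Hw)_a − t² H a a)
  have hfq : f q = γ * (c * ∑ x, w x * ∑ y, H x y * w y) := by
    rw [hf q, hqlast]
    simp_rw [hqe]
  have hfp : f p = γ * (c * (∑ x, w x * ∑ y, H x y * w y - 2 * t * ∑ y, H a y * w y + t ^ 2 * H a a)) := by
    rw [hf p, hplast]
    simp_rw [hpe]
    rw [quad_update hsym]
  have hrowa : γ * (Fintype.card X : ℝ) / 4 ≤ ∑ y, H a y * w y := hadamard_testRow_ge horth hone hrow hγ.le a
  have hHaa : H a a ≤ 1 := by rcases hone a a with h | h <;> norm_num [h]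
  have hn : (1 : ℝ) ≤ Fintype.card X := by
    exact_mod_cast Fintype.card_pos_iff.2 ⟨x₀⟩
  have hdiff : c * γ ^ 3 * (Fintype.card X : ℝ) / 16 ≤ f q - f p := by
    rw [hfq, hfp, ht]
    have h1 : 0 ≤ c * γ := mul_nonneg hc hγ.le
    nlinarith [mul_le_mul_of_nonneg_left hrowa h1, mul_le_mul_of_nonneg_left hHaa (by positivity : 0 ≤ c * γ ^ 3),
      mul_le_mul_of_nonneg_left hn (by positivity : 0 ≤ c * γ ^ 3)]
  have habs : f q - f p ≤ Λ (e a) * t := (le_abs_self _).trans hLip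
  rw [ht] at habs
  nlinarith

end Witness

end Summit.QuantumFields.BalabanUV.Beta.EriceRemainderEnclosureHistoryAnalyticWalsh

end
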